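import Summits.KontsevichZagierPeriods.KontsevichZagierPeriods.Theorems.FurushoPentagonPentagonInKZCornerCubes
import Summits.KontsevichZagierPeriods.KontsevichZagierPeriods.Theorems.FurushoPentagonPentagonInKZCornerEngineCollect

/-!
# `PentagonInKZ`, line `edge-normal-newton-leibniz`: corner engine — collecting the two sides (degree `n − 2`)

Part of the proof of `cornerEngine_uniformlyNull` (crux `FurushoPentagon.PentagonInKZ`,
stmt-KontsevichZagierPeriods-11348), in the ABSTRACT form of the corner engine (all objects hypothesised,
their properties forming ONE hypothesis bundle `H`; see `…CornerEngineCollect.lean`).  This file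
proves the degree-`(n−2)` cancellation `collect_deg2`: the level-`(n−2)` terms `E a` of Step A
and `E' b` of its mirror image (read over the direct cube `[0,1]^{k+l+(e+2)}` by
`collect_unmirror_rep`) differ by (minus) the sum over pairs of letters of the instances `Φ₂ a b`
of uniform nullity in degree `n − 2`; the remaining terms are, pointwise on the open cube, the
weighted sum of commutators `Σ_{a,b} fd_a gd_b [μ(op_a opV_b X) − μ(opV_b op_a X)]`, which
vanishes by flatness (`sum_weight_commutator`) inside the rectangle and trivially where the
(normalised) weight vanishes.  The class-level statement is integrand additivity off the null
boundary of the cube (`CornerCubes.cls_finset_sum_open`).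

* `collect_sum_comm₄`, `collect_sum_vanish`, `collect_sum_bookkeeping` — the finite-sum
  bookkeeping (pure algebra);
* `collect_deg2` — the cancellation.

References: [KontsevichZagier2001, §1.2 rules (1), (2)], [Drinfeld1991, §2].
-/

noncomputable section

open Set MeasureTheory
open Literature.NumberTheory.Transcendental
open Literature.ModelTheory.ExponentialFields (IsSemialgebraic)

namespace Summit.KontsevichZagierPeriods.FurushoPentagon.PentagonInKZ

section AbstractEngine

variable {m N : ℕ} {ℓ ℓ' : Fin (m + 2)} {α β : ℚ}
  {Zq : Fin (m + 2) → (DrinfeldKohnoTrunc ℚ (Fin 4) N)} {wZ : ∀ {n : ℕ}, (Fin n → Fin (m + 2)) → (DrinfeldKohnoTrunc ℚ (Fin 4) N)}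
  {fd gd dd : Fin (m + 2) → ℝ → ℝ → ℝ}
  {Ht Vt dHt dVt : ∀ {n : ℕ}, (Fin n → Fin (m + 2)) → (Fin n → ℝ) → ℝ → ℝ → ℝ}
  {op opV : Fin (m + 2) → (DrinfeldKohnoTrunc ℚ (Fin 4) N) →ₗ[ℚ] (DrinfeldKohnoTrunc ℚ (Fin 4) N)}
  {Af Bf dAf dBf F : ((DrinfeldKohnoTrunc ℚ (Fin 4) N) →ₗ[ℚ] ℚ) → ∀ {k l : ℕ}, (Fin k → ℝ) → (Fin l → ℝ) → ℝ → ℝ → ℝ}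
  {Xb : ∀ k l e : ℕ, (Fin (k + l + e) → ℝ) → Fin k → ℝ}
  {Yb : ∀ k l e : ℕ, (Fin (k + l + e) → ℝ) → Fin l → ℝ}
  {Θb : ∀ k l e : ℕ, (Fin (k + l + e) → ℝ) → Fin e → ℝ}

variable (H :
    (∀ {n : ℕ} (U : Fin n → Fin (m + 2)), wZ U = ((List.ofFn U).map Zq).prod) ∧
    (∀ (a : Fin (m + 2)) (X : (DrinfeldKohnoTrunc ℚ (Fin 4) N)), op a X = if a = ℓ then Zq ℓ * X - X * Zq ℓ else Zq a * X) ∧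
    (∀ (b : Fin (m + 2)) (X : (DrinfeldKohnoTrunc ℚ (Fin 4) N)), opV b X = if b = ℓ' then Zq ℓ' * X - X * Zq ℓ' else Zq b * X) ∧
    (∀ (μ : (DrinfeldKohnoTrunc ℚ (Fin 4) N) →ₗ[ℚ] ℚ) {k l : ℕ} (x : Fin k → ℝ) (y : Fin l → ℝ) (ξ η : ℝ), Af μ x y ξ η = ∑ U : Fin k → Fin (m + 2), ∑ V : Fin l → Fin (m + 2), (μ (wZ U * wZ V) : ℝ) * (Ht U x ξ η * Vt V y 0 η)) ∧
    (∀ (μ : (DrinfeldKohnoTrunc ℚ (Fin 4) N) →ₗ[ℚ] ℚ) {k l : ℕ} (x : Fin k → ℝ) (y : Fin l → ℝ) (ξ η : ℝ), Bf μ x y ξ η = ∑ U : Fin k → Fin (m + 2), ∑ V : Fin l → Fin (m + 2), (μ (wZ V * wZ U) : ℝ) * (Vt V y ξ η * Ht U x ξ 0)) ∧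
    (∀ (μ : (DrinfeldKohnoTrunc ℚ (Fin 4) N) →ₗ[ℚ] ℚ) {k l : ℕ} (x : Fin k → ℝ) (y : Fin l → ℝ) (ξ η : ℝ), dAf μ x y ξ η = ∑ U : Fin k → Fin (m + 2), ∑ V : Fin l → Fin (m + 2), (μ (wZ U * wZ V) : ℝ) * (dHt U x ξ η * Vt V y 0 η)) ∧
    (∀ (μ : (DrinfeldKohnoTrunc ℚ (Fin 4) N) →ₗ[ℚ] ℚ) {k l : ℕ} (x : Fin k → ℝ) (y : Fin l → ℝ) (ξ η : ℝ), dBf μ x y ξ η = ∑ U : Fin k → Fin (m + 2), ∑ V : Fin l → Fin (m + 2), (μ (wZ V * wZ U) : ℝ) * (dVt V y ξ η * Ht U x ξ 0)) ∧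
    (∀ (μ : (DrinfeldKohnoTrunc ℚ (Fin 4) N) →ₗ[ℚ] ℚ) {k l : ℕ} (x : Fin k → ℝ) (y : Fin l → ℝ) (ξ η : ℝ), F μ x y ξ η = Af μ x y ξ η - Bf μ x y ξ η) ∧
    (∀ (k l e : ℕ) (z : Fin (k + l + e) → ℝ), Xb k l e z = fun i => z (Fin.castAdd e (Fin.castAdd l i))) ∧
    (∀ (k l e : ℕ) (z : Fin (k + l + e) → ℝ), Yb k l e z = fun j => z (Fin.castAdd e (Fin.natAdd k j))) ∧
    (∀ (k l e : ℕ) (z : Fin (k + l + e) → ℝ), Θb k l e z = fun s => z (Fin.natAdd (k + l) s)) ∧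
    (∀ (U : Fin 0 → Fin (m + 2)) (x : Fin 0 → ℝ) (ξ η : ℝ), Ht U x ξ η = 1) ∧
    (∀ (V : Fin 0 → Fin (m + 2)) (y : Fin 0 → ℝ) (ξ η : ℝ), Vt V y ξ η = 1) ∧
    (∀ (U : Fin 0 → Fin (m + 2)) (x : Fin 0 → ℝ) (ξ η : ℝ), dHt U x ξ η = 0) ∧
    (∀ (V : Fin 0 → Fin (m + 2)) (y : Fin 0 → ℝ) (ξ η : ℝ), dVt V y ξ η = 0) ∧
    (∀ {k : ℕ} (U : Fin (k + 1) → Fin (m + 2)) (x : Fin (k + 1) → ℝ) (η : ℝ), Ht U x 0 η = 0) ∧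
    (∀ {l : ℕ} (V : Fin (l + 1) → Fin (m + 2)) (y : Fin (l + 1) → ℝ) (ξ : ℝ), Vt V y ξ 0 = 0) ∧
    (∀ t y : ℝ, fd ℓ t y = 1 / t) ∧
    (∀ x s : ℝ, gd ℓ' x s = 1 / s) ∧
    (∀ x y : ℝ, dd ℓ x y = 0) ∧
    (∀ x y : ℝ, dd ℓ' x y = 0) ∧
    (∀ (μ : (DrinfeldKohnoTrunc ℚ (Fin 4) N) →ₗ[ℚ] ℚ) {k : ℕ} (x₀ : ℝ) (x' : Fin k → ℝ) (ξ η : ℝ), ∑ U : Fin (k + 1) → Fin (m + 2), (μ (wZ U) : ℝ) * Ht U (Fin.cons x₀ x') ξ η = (∑ a : Fin (m + 2), (if a = ℓ then 1 / x₀ else ξ * fd a (ξ * x₀) η) * ∑ U' : Fin k → Fin (m + 2), (μ (Zq a * wZ U') : ℝ) * Ht U' x' (ξ * x₀) η) - (1 / x₀) * ∑ U' : Fin k → Fin (m + 2), (μ (wZ U' * Zq ℓ) : ℝ) * Ht U' x' (ξ * x₀) η) ∧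
    (∀ (μ : (DrinfeldKohnoTrunc ℚ (Fin 4) N) →ₗ[ℚ] ℚ) {l : ℕ} (y₀ : ℝ) (y' : Fin l → ℝ) (ξ η : ℝ), ∑ V : Fin (l + 1) → Fin (m + 2), (μ (wZ V) : ℝ) * Vt V (Fin.cons y₀ y') ξ η = (∑ b : Fin (m + 2), (if b = ℓ' then 1 / y₀ else η * gd b ξ (η * y₀)) * ∑ V' : Fin l → Fin (m + 2), (μ (Zq b * wZ V') : ℝ) * Vt V' y' ξ (η * y₀)) - (1 / y₀) * ∑ V' : Fin l → Fin (m + 2), (μ (wZ V' * Zq ℓ') : ℝ) * Vt V' y' ξ (η * y₀)) ∧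
    (∀ (μ : (DrinfeldKohnoTrunc ℚ (Fin 4) N) →ₗ[ℚ] ℚ) {l : ℕ} (P Q : (DrinfeldKohnoTrunc ℚ (Fin 4) N)) (y : Fin l → ℝ) (η : ℝ), (∀ i, 0 < y i ∧ y i < 1) → 0 < η → η ≤ (β : ℝ) → ∑ V : Fin l → Fin (m + 2), (μ (P * (Zq ℓ * wZ V - wZ V * Zq ℓ) * Q) : ℝ) * Vt V y 0 η = 0) ∧
    (∀ (μ : (DrinfeldKohnoTrunc ℚ (Fin 4) N) →ₗ[ℚ] ℚ) {k : ℕ} (P Q : (DrinfeldKohnoTrunc ℚ (Fin 4) N)) (x : Fin k → ℝ) (ξ : ℝ), (∀ i, 0 < x i ∧ x i < 1) → 0 < ξ → ξ ≤ (α : ℝ) → ∑ U : Fin k → Fin (m + 2), (μ (P * (Zq ℓ' * wZ U - wZ U * Zq ℓ') * Q) : ℝ) * Ht U x ξ 0 = 0) ∧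
    (∀ (μ : (DrinfeldKohnoTrunc ℚ (Fin 4) N) →ₗ[ℚ] ℚ) (P Q : (DrinfeldKohnoTrunc ℚ (Fin 4) N)), μ (P * (Zq ℓ * Zq ℓ' - Zq ℓ' * Zq ℓ) * Q) = 0) ∧
    (∀ (μ : (DrinfeldKohnoTrunc ℚ (Fin 4) N) →ₗ[ℚ] ℚ) (P Q : (DrinfeldKohnoTrunc ℚ (Fin 4) N)) (x y : ℝ), 0 < x → x < (α : ℝ) → 0 < y → y < (β : ℝ) → ∑ a : Fin (m + 2), ∑ b : Fin (m + 2), (fd a x y * gd b x y) * (μ (P * (Zq a * Zq b - Zq b * Zq a) * Q) : ℝ) = 0) ∧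
    (∀ (μ : (DrinfeldKohnoTrunc ℚ (Fin 4) N) →ₗ[ℚ] ℚ) (P Q : (DrinfeldKohnoTrunc ℚ (Fin 4) N)) (s : ℝ), 0 < s → s < (β : ℝ) → ∑ b : Fin (m + 2), gd b 0 s * (μ (P * (Zq ℓ * Zq b - Zq b * Zq ℓ) * Q) : ℝ) = 0) ∧
    (∀ (μ : (DrinfeldKohnoTrunc ℚ (Fin 4) N) →ₗ[ℚ] ℚ) (P Q : (DrinfeldKohnoTrunc ℚ (Fin 4) N)) (t : ℝ), 0 < t → t < (α : ℝ) → ∑ a : Fin (m + 2), fd a t 0 * (μ (P * (Zq ℓ' * Zq a - Zq a * Zq ℓ') * Q) : ℝ) = 0) ∧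
    (∀ (a : Fin (m + 2)) (ξ η : ℝ), 0 ≤ ξ → ξ ≤ (α : ℝ) → 0 ≤ η → η ≤ (β : ℝ) → HasDerivAt (fun y => fd a ξ y) (dd a ξ η) η) ∧
    (∀ (b : Fin (m + 2)) (ξ η : ℝ), 0 ≤ ξ → ξ ≤ (α : ℝ) → 0 ≤ η → η ≤ (β : ℝ) → HasDerivAt (fun x => gd b x η) (dd b ξ η) ξ) ∧
    (∀ {k : ℕ} (U : Fin k → Fin (m + 2)) (x : Fin k → ℝ) (ξ η : ℝ), (∀ i, 0 ≤ x i ∧ x i ≤ 1) → 0 ≤ ξ → ξ ≤ (α : ℝ) → 0 ≤ η → η ≤ (β : ℝ) → HasDerivAt (fun t => Ht U x t η) (dHt U x ξ η) ξ) ∧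
    (∀ {l : ℕ} (V : Fin l → Fin (m + 2)) (y : Fin l → ℝ) (ξ η : ℝ), (∀ i, 0 ≤ y i ∧ y i ≤ 1) → 0 ≤ ξ → ξ ≤ (α : ℝ) → 0 ≤ η → η ≤ (β : ℝ) → HasDerivAt (fun s => Vt V y ξ s) (dVt V y ξ η) η) ∧
    (∀ {k : ℕ} (U : Fin (k + 1) → Fin (m + 2)) (x₀ : ℝ) (x' : Fin k → ℝ) (ξ η : ℝ), 0 < x₀ → x₀ < 1 → (∀ i, 0 ≤ x' i ∧ x' i ≤ 1) → 0 ≤ ξ → ξ ≤ (α : ℝ) → 0 ≤ η → η ≤ (β : ℝ) → HasDerivAt (fun t => t * Ht U (Fin.cons t x') ξ η) (ξ * dHt U (Fin.cons x₀ x') ξ η) x₀) ∧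
    (∀ {l : ℕ} (V : Fin (l + 1) → Fin (m + 2)) (y₀ : ℝ) (y' : Fin l → ℝ) (ξ η : ℝ), 0 < y₀ → y₀ < 1 → (∀ i, 0 ≤ y' i ∧ y' i ≤ 1) → 0 ≤ ξ → ξ ≤ (α : ℝ) → 0 ≤ η → η ≤ (β : ℝ) → HasDerivAt (fun t => t * Vt V (Fin.cons t y') ξ η) (η * dVt V (Fin.cons y₀ y') ξ η) y₀) ∧
    (∀ {k : ℕ} (U : Fin (k + 1) → Fin (m + 2)) (x' : Fin k → ℝ) (ξ η : ℝ), (∀ i, 0 ≤ x' i ∧ x' i ≤ 1) → 0 ≤ ξ → ξ ≤ (α : ℝ) → 0 ≤ η → η ≤ (β : ℝ) → ContinuousOn (fun t => t * Ht U (Fin.cons t x') ξ η) (Set.Icc 0 1)) ∧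
    (∀ {l : ℕ} (V : Fin (l + 1) → Fin (m + 2)) (y' : Fin l → ℝ) (ξ η : ℝ), (∀ i, 0 ≤ y' i ∧ y' i ≤ 1) → 0 ≤ ξ → ξ ≤ (α : ℝ) → 0 ≤ η → η ≤ (β : ℝ) → ContinuousOn (fun t => t * Vt V (Fin.cons t y') ξ η) (Set.Icc 0 1)) ∧
    (∀ {d : ℕ} {W : Set (Fin d → ℝ)}, IsSemialgebraic ℚ W → ∀ (a : Fin (m + 2)) {T Y : (Fin d → ℝ) → ℝ}, IsSemialgebraicFunOn ℚ W T → IsSemialgebraicFunOn ℚ W Y → IsSemialgebraicFunOn ℚ W fun z => fd a (T z) (Y z)) ∧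
    (∀ {d : ℕ} {W : Set (Fin d → ℝ)}, IsSemialgebraic ℚ W → ∀ (b : Fin (m + 2)) {T Y : (Fin d → ℝ) → ℝ}, IsSemialgebraicFunOn ℚ W T → IsSemialgebraicFunOn ℚ W Y → IsSemialgebraicFunOn ℚ W fun z => gd b (T z) (Y z)) ∧
    (∀ {d : ℕ} {W : Set (Fin d → ℝ)}, IsSemialgebraic ℚ W → ∀ (a : Fin (m + 2)) {T Y : (Fin d → ℝ) → ℝ}, IsSemialgebraicFunOn ℚ W T → IsSemialgebraicFunOn ℚ W Y → IsSemialgebraicFunOn ℚ W fun z => dd a (T z) (Y z)) ∧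
    (∀ {d : ℕ} {W : Set (Fin d → ℝ)}, IsSemialgebraic ℚ W → ∀ {n : ℕ} (U : Fin n → Fin (m + 2)) {X : (Fin d → ℝ) → Fin n → ℝ} {P Q : (Fin d → ℝ) → ℝ}, (∀ i, IsSemialgebraicFunOn ℚ W fun z => X z i) → IsSemialgebraicFunOn ℚ W P → IsSemialgebraicFunOn ℚ W Q → IsSemialgebraicFunOn ℚ W fun z => Ht U (X z) (P z) (Q z)) ∧
    (∀ {d : ℕ} {W : Set (Fin d → ℝ)}, IsSemialgebraic ℚ W → ∀ {n : ℕ} (V : Fin n → Fin (m + 2)) {Y : (Fin d → ℝ) → Fin n → ℝ} {P Q : (Fin d → ℝ) → ℝ}, (∀ i, IsSemialgebraicFunOn ℚ W fun z => Y z i) → IsSemialgebraicFunOn ℚ W P → IsSemialgebraicFunOn ℚ W Q → IsSemialgebraicFunOn ℚ W fun z => Vt V (Y z) (P z) (Q z)) ∧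
    (∀ {d : ℕ} {W : Set (Fin d → ℝ)}, IsSemialgebraic ℚ W → ∀ {n : ℕ} (U : Fin n → Fin (m + 2)) {X : (Fin d → ℝ) → Fin n → ℝ} {P Q : (Fin d → ℝ) → ℝ}, (∀ i, IsSemialgebraicFunOn ℚ W fun z => X z i) → IsSemialgebraicFunOn ℚ W P → IsSemialgebraicFunOn ℚ W Q → IsSemialgebraicFunOn ℚ W fun z => dHt U (X z) (P z) (Q z)) ∧
    (∀ {d : ℕ} {W : Set (Fin d → ℝ)}, IsSemialgebraic ℚ W → ∀ {n : ℕ} (V : Fin n → Fin (m + 2)) {Y : (Fin d → ℝ) → Fin n → ℝ} {P Q : (Fin d → ℝ) → ℝ}, (∀ i, IsSemialgebraicFunOn ℚ W fun z => Y z i) → IsSemialgebraicFunOn ℚ W P → IsSemialgebraicFunOn ℚ W Q → IsSemialgebraicFunOn ℚ W fun z => dVt V (Y z) (P z) (Q z)) ∧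
    (∃ C : ℝ, ∀ (a : Fin (m + 2)) (ξ η : ℝ), 0 ≤ ξ → ξ ≤ (α : ℝ) → 0 ≤ η → η ≤ (β : ℝ) → (a ≠ ℓ → |fd a ξ η| ≤ C) ∧ (a ≠ ℓ' → |gd a ξ η| ≤ C) ∧ |dd a ξ η| ≤ C ∧ (∀ η' : ℝ, 0 ≤ η' → η' ≤ (β : ℝ) → |fd a ξ η - fd a ξ η'| ≤ C * |η - η'|) ∧ (∀ ξ' : ℝ, 0 ≤ ξ' → ξ' ≤ (α : ℝ) → |gd a ξ η - gd a ξ' η| ≤ C * |ξ - ξ'|)) ∧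
    (∀ k : ℕ, ∃ C : ℝ, ∀ (U : Fin k → Fin (m + 2)) (x : Fin k → ℝ) (ξ η : ℝ), (∀ i, 0 ≤ x i ∧ x i ≤ 1) → 0 ≤ ξ → ξ ≤ (α : ℝ) → 0 ≤ η → η ≤ (β : ℝ) → |Ht U x ξ η| ≤ C ∧ |dHt U x ξ η| ≤ C ∧ (0 < k → |Ht U x ξ η| ≤ C * ξ) ∧ (∀ η' : ℝ, 0 ≤ η' → η' ≤ (β : ℝ) → |Ht U x ξ η - Ht U x ξ η'| ≤ C * ξ * |η - η'|)) ∧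
    (∀ l : ℕ, ∃ C : ℝ, ∀ (V : Fin l → Fin (m + 2)) (y : Fin l → ℝ) (ξ η : ℝ), (∀ i, 0 ≤ y i ∧ y i ≤ 1) → 0 ≤ ξ → ξ ≤ (α : ℝ) → 0 ≤ η → η ≤ (β : ℝ) → |Vt V y ξ η| ≤ C ∧ |dVt V y ξ η| ≤ C ∧ (0 < l → |Vt V y ξ η| ≤ C * η) ∧ (∀ ξ' : ℝ, 0 ≤ ξ' → ξ' ≤ (α : ℝ) → |Vt V y ξ η - Vt V y ξ' η| ≤ C * η * |ξ - ξ'|)))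

/-! ### Finite-sum bookkeeping -/

/-- Commuting a fourfold finite sum: the two outer summations past the two inner ones.
[folklore] -/
theorem collect_sum_comm₄ {ι₁ ι₂ κ₁ κ₂ M : Type*} [Fintype ι₁] [Fintype ι₂] [Fintype κ₁] [Fintype κ₂]
    [AddCommMonoid M] (t : ι₁ → ι₂ → κ₁ → κ₂ → M) :
    ∑ a, ∑ b, ∑ U, ∑ V, t a b U V = ∑ U, ∑ V, ∑ a, ∑ b, t a b U V := by
  calc ∑ a, ∑ b, ∑ U, ∑ V, t a b U V = ∑ a, ∑ U, ∑ V, ∑ b, t a b U V := by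
        refine Finset.sum_congr rfl fun a _ => ?_
        rw [Finset.sum_comm]
        refine Finset.sum_congr rfl fun U _ => ?_
        rw [Finset.sum_comm]
    _ = ∑ U, ∑ a, ∑ V, ∑ b, t a b U V := by rw [Finset.sum_comm]
    _ = ∑ U, ∑ V, ∑ a, ∑ b, t a b U V := by
        refine Finset.sum_congr rfl fun U _ => ?_
        rw [Finset.sum_comm]

/-- **Vanishing of a weighted double sum of differences of double sums**: if for all `U, V` the
weighted sum `Σ_{a,b} f_a g_b (d₁ − d₂)_{abUV}` vanishes, then so does
`Σ_{a,b} f_a g_b (Σ_{U,V} d₁ c − Σ_{U,V} d₂ c)`. [folklore] -/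
theorem collect_sum_vanish {ι κ₁ κ₂ : Type*} [Fintype ι] [Fintype κ₁] [Fintype κ₂]
    (f g : ι → ℝ) (c : κ₁ → κ₂ → ℝ) (d₁ d₂ : ι → ι → κ₁ → κ₂ → ℝ)
    (h : ∀ U V, ∑ a, ∑ b, f a * g b * (d₁ a b U V - d₂ a b U V) = 0) :
    ∑ a, ∑ b, f a * g b * ((∑ U, ∑ V, d₁ a b U V * c U V) - ∑ U, ∑ V, d₂ a b U V * c U V) = 0 := by
  calc ∑ a, ∑ b, f a * g b * ((∑ U, ∑ V, d₁ a b U V * c U V) - ∑ U, ∑ V, d₂ a b U V * c U V)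
      = ∑ a, ∑ b, ∑ U, ∑ V, f a * g b * (d₁ a b U V - d₂ a b U V) * c U V := by
        refine Finset.sum_congr rfl fun a _ => Finset.sum_congr rfl fun b _ => ?_
        rw [← Finset.sum_sub_distrib, Finset.mul_sum]
        refine Finset.sum_congr rfl fun U _ => ?_
        rw [← Finset.sum_sub_distrib, Finset.mul_sum]
        exact Finset.sum_congr rfl fun V _ => by ring
    _ = ∑ U, ∑ V, ∑ a, ∑ b, f a * g b * (d₁ a b U V - d₂ a b U V) * c U V := collect_sum_comm₄ _
    _ = 0 := by
        refine Finset.sum_eq_zero fun U _ => Finset.sum_eq_zero fun V _ => ?_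
        simp only [← Finset.sum_mul, h, zero_mul]

/-- **Bookkeeping of the degree `n − 2` collection**: if `ρ Σ_{a,b} f_a g_b (B'_{ab} − B_{ab}) = 0`
then `Σ_b ρ g_b Σ_a f_a A_{ab} = Σ_a ρ f_a Σ_b g_b B'_{ab} + Σ_{a,b} ρ f_a g_b (A_{ab} − B_{ab})`.
[folklore] -/
theorem collect_sum_bookkeeping {ι : Type*} [Fintype ι] (ρ : ℝ) (f g : ι → ℝ) (A B B' : ι → ι → ℝ)
    (h : ρ * ∑ a, ∑ b, f a * g b * (B' a b - B a b) = 0) :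
    ∑ b, ρ * (g b * ∑ a, f a * A a b) =
      ∑ a, ρ * (f a * ∑ b, g b * B' a b) + ∑ a, ∑ b, ρ * (f a * g b) * (A a b - B a b) := by
  have e1 : ∑ b, ρ * (g b * ∑ a, f a * A a b) = ∑ a, ∑ b, ρ * (f a * g b * A a b) := by
    rw [Finset.sum_comm]
    refine Finset.sum_congr rfl fun b _ => ?_
    rw [Finset.mul_sum, Finset.mul_sum]
    exact Finset.sum_congr rfl fun a _ => by ring
  have e2 : ∑ a, ρ * (f a * ∑ b, g b * B' a b) = ∑ a, ∑ b, ρ * (f a * g b * B' a b) := by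
    refine Finset.sum_congr rfl fun a _ => ?_
    rw [Finset.mul_sum, Finset.mul_sum]
    exact Finset.sum_congr rfl fun b _ => by ring
  have e3 : ρ * ∑ a, ∑ b, f a * g b * (B' a b - B a b) = ∑ a, ∑ b, ρ * (f a * g b * (B' a b - B a b)) := by
    rw [Finset.mul_sum]
    exact Finset.sum_congr rfl fun a _ => Finset.mul_sum _ _ _
  rw [e3] at h
  rw [e1, e2, ← Finset.sum_add_distrib, ← sub_eq_zero, ← Finset.sum_sub_distrib, ← neg_eq_zero, ← h,
    ← Finset.sum_neg_distrib]
  refine Finset.sum_congr rfl fun a _ => ?_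
  rw [← Finset.sum_add_distrib, ← Finset.sum_sub_distrib, ← Finset.sum_neg_distrib]
  exact Finset.sum_congr rfl fun b _ => by ring

/-! ### Collecting the two sides in degree `n − 2` -/

include H in
/-- **Degree `n − 2` cancellation**: the level-`(n−2)` terms of the two sides differ by (minus) a
sum over pairs of letters of instances of uniform nullity in degree `n − 2`, the remaining
commutator terms vanishing pointwise by flatness (`sum_weight_commutator`). [cite: Drinfeld1991, §2] -/
theorem collect_deg2 (μ : (DrinfeldKohnoTrunc ℚ (Fin 4) N) →ₗ[ℚ] ℚ) (k l e : ℕ) (Ξ Η σ : (Fin e → ℝ) → ℝ)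
    (hΞΗ : ∀ θ ∈ KZ.cube e, 0 ≤ Ξ θ ∧ Ξ θ ≤ (α : ℝ) ∧ 0 ≤ Η θ ∧ Η θ ≤ (β : ℝ))
    (hσ0 : ∀ θ ∈ KZ.cube e, Ξ θ = 0 ∨ Η θ = 0 → σ θ = 0)
    (Ξ₂ Η₂ ρ₂ : (Fin (e + 2) → ℝ) → ℝ)
    (hΞ₂ : ∀ θ'', Ξ₂ θ'' = Ξ (Fin.init (Fin.init θ'')) * θ'' (Fin.castSucc (Fin.last e)))
    (hΗ₂ : ∀ θ'', Η₂ θ'' = Η (Fin.init (Fin.init θ'')) * θ'' (Fin.last (e + 1)))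
    (hρ₂ : ∀ θ'', ρ₂ θ'' = σ (Fin.init (Fin.init θ'')) * Ξ (Fin.init (Fin.init θ'')) * Η (Fin.init (Fin.init θ'')))
    (E : Fin (m + 2) → KZ.IntegralRep (k + l + (e + 2))) (hEd : ∀ a, (E a).domain = KZ.cube (k + l + (e + 2)))
    (hEi : ∀ a, (E a).integrand = fun w => ρ₂ (Θb k l (e + 2) w) *
      (fd a (Ξ₂ (Θb k l (e + 2) w)) (Η₂ (Θb k l (e + 2) w)) *
        ∑ b : Fin (m + 2), gd b (Ξ₂ (Θb k l (e + 2) w)) (Η₂ (Θb k l (e + 2) w)) *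
          Bf ((μ ∘ₗ op a) ∘ₗ opV b) (Xb k l (e + 2) w) (Yb k l (e + 2) w)
            (Ξ₂ (Θb k l (e + 2) w)) (Η₂ (Θb k l (e + 2) w))))
    (E' : Fin (m + 2) → KZ.IntegralRep (l + k + (e + 2))) (hE'd : ∀ b, (E' b).domain = KZ.cube (l + k + (e + 2)))
    (hE'i : ∀ b, (E' b).integrand = fun w =>
      ρ₂ (fun s => Θb l k (e + 2) w (Equiv.swap (Fin.castSucc (Fin.last e)) (Fin.last (e + 1)) s)) *
      (gd b (Ξ₂ (fun s => Θb l k (e + 2) w (Equiv.swap (Fin.castSucc (Fin.last e)) (Fin.last (e + 1)) s)))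
          (Η₂ (fun s => Θb l k (e + 2) w (Equiv.swap (Fin.castSucc (Fin.last e)) (Fin.last (e + 1)) s))) *
        ∑ a : Fin (m + 2),
          fd a (Ξ₂ (fun s => Θb l k (e + 2) w (Equiv.swap (Fin.castSucc (Fin.last e)) (Fin.last (e + 1)) s)))
            (Η₂ (fun s => Θb l k (e + 2) w (Equiv.swap (Fin.castSucc (Fin.last e)) (Fin.last (e + 1)) s))) *
          Af ((μ ∘ₗ opV b) ∘ₗ op a) (Yb l k (e + 2) w) (Xb l k (e + 2) w)
            (Ξ₂ (fun s => Θb l k (e + 2) w (Equiv.swap (Fin.castSucc (Fin.last e)) (Fin.last (e + 1)) s)))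
            (Η₂ (fun s => Θb l k (e + 2) w (Equiv.swap (Fin.castSucc (Fin.last e)) (Fin.last (e + 1)) s)))))
    (Φ₂ : Fin (m + 2) → Fin (m + 2) → KZ.IntegralRep (k + l + (e + 2)))
    (hΦ₂d : ∀ a b, (Φ₂ a b).domain = KZ.cube (k + l + (e + 2)))
    (hΦ₂i : ∀ a b, (Φ₂ a b).integrand = fun w => ρ₂ (Θb k l (e + 2) w) *
      (fd a (Ξ₂ (Θb k l (e + 2) w)) (Η₂ (Θb k l (e + 2) w)) * gd b (Ξ₂ (Θb k l (e + 2) w)) (Η₂ (Θb k l (e + 2) w))) *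
      F ((μ ∘ₗ opV b) ∘ₗ op a) (Xb k l (e + 2) w) (Yb k l (e + 2) w) (Ξ₂ (Θb k l (e + 2) w)) (Η₂ (Θb k l (e + 2) w))) :
    ∑ a : Fin (m + 2), KZ.toPeriodAlgebra (KZ.toFormalPeriod (KZ.of (E a))) -
      ∑ b : Fin (m + 2), KZ.toPeriodAlgebra (KZ.toFormalPeriod (KZ.of (E' b))) =
      - ∑ a : Fin (m + 2), ∑ b : Fin (m + 2), KZ.toPeriodAlgebra (KZ.toFormalPeriod (KZ.of (Φ₂ a b))) := by
  have H' := H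
  obtain ⟨_, _, _, _, hBf, _, _, hF, _, _, hΘb, -⟩ := H'
  -- read the mirror terms over the direct cube
  have hex : ∀ b : Fin (m + 2), ∃ r' : KZ.IntegralRep (k + l + (e + 2)), r'.domain = KZ.cube (k + l + (e + 2)) ∧
      (r'.integrand = fun z => ρ₂ (Θb k l (e + 2) z) *
        (gd b (Ξ₂ (Θb k l (e + 2) z)) (Η₂ (Θb k l (e + 2) z)) *
          ∑ a : Fin (m + 2), fd a (Ξ₂ (Θb k l (e + 2) z)) (Η₂ (Θb k l (e + 2) z)) *
            Af ((μ ∘ₗ opV b) ∘ₗ op a) (Xb k l (e + 2) z) (Yb k l (e + 2) z)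
              (Ξ₂ (Θb k l (e + 2) z)) (Η₂ (Θb k l (e + 2) z)))) ∧
      KZ.toPeriodAlgebra (KZ.toFormalPeriod (KZ.of r')) = KZ.toPeriodAlgebra (KZ.toFormalPeriod (KZ.of (E' b))) :=
    fun b => collect_unmirror_rep H (k := k) (l := l) (e := e)
      (fun x y Θ => ρ₂ Θ * (gd b (Ξ₂ Θ) (Η₂ Θ) * ∑ a : Fin (m + 2), fd a (Ξ₂ Θ) (Η₂ Θ) *
        Af ((μ ∘ₗ opV b) ∘ₗ op a) x y (Ξ₂ Θ) (Η₂ Θ))) (E' b) (hE'd b) (hE'i b)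
  choose E'' hE''d hE''i hE''c using hex
  -- the sum of the un-mirrored terms as ONE representation on the cube
  obtain ⟨T, hTd, hTi⟩ : ∃ T : KZ.IntegralRep (k + l + (e + 2)), T.domain = KZ.cube (k + l + (e + 2)) ∧
      T.integrand = fun z => ∑ b : Fin (m + 2), (E'' b).integrand z :=
    ⟨⟨KZ.cube _, fun z => ∑ b : Fin (m + 2), (E'' b).integrand z, KZ.isSemialgebraic_cube,
      IsSemialgebraicFunOn.fun_finsetSum Finset.univ KZ.isSemialgebraic_cube fun b _ => by
        rw [← hE''d b]; exact (E'' b).isSemialgebraicFunOn_integrand,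
      integrable_finsetSum Finset.univ fun b _ => by rw [← hE''d b]; exact (E'' b).integrableOn⟩, rfl, rfl⟩
  have hT₂ : KZ.toPeriodAlgebra (KZ.toFormalPeriod (KZ.of T)) =
      ∑ b : Fin (m + 2), KZ.toPeriodAlgebra (KZ.toFormalPeriod (KZ.of (E'' b))) :=
    CornerCubes.cls_finset_sum Finset.univ T E'' (fun b _ => (hE''d b).trans hTd.symm) fun z _ => by rw [hTi]
  -- the pointwise identity on the open cube: `Σ_b E'' b = Σ_a E a + Σ_{a,b} Φ₂ a b`
  have hpt : ∀ z ∈ openUnitCube (k + l + (e + 2)), T.integrand z =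
      ∑ i ∈ (Finset.univ : Finset (Fin (m + 2) ⊕ (Fin (m + 2) × Fin (m + 2)))),
        (Sum.elim E (fun p => Φ₂ p.1 p.2) i).integrand z := by
    intro z hz
    rw [Fintype.sum_sum_type, hTi]
    simp only [Sum.elim_inl, Sum.elim_inr, Fintype.sum_prod_type, hE''i, hEi, hΦ₂i, hF]
    have hΘo : Θb k l (e + 2) z ∈ openUnitCube (e + 2) := by rw [hΘb]; exact fun s => hz _
    set Θ := Θb k l (e + 2) z
    set x := Xb k l (e + 2) z
    set y := Yb k l (e + 2) z
    refine collect_sum_bookkeeping (ρ₂ Θ) (fun a => fd a (Ξ₂ Θ) (Η₂ Θ)) (fun b => gd b (Ξ₂ Θ) (Η₂ Θ))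
      (fun a b => Af ((μ ∘ₗ opV b) ∘ₗ op a) x y (Ξ₂ Θ) (Η₂ Θ))
      (fun a b => Bf ((μ ∘ₗ opV b) ∘ₗ op a) x y (Ξ₂ Θ) (Η₂ Θ))
      (fun a b => Bf ((μ ∘ₗ op a) ∘ₗ opV b) x y (Ξ₂ Θ) (Η₂ Θ)) ?_
    -- the commutator terms vanish by flatness inside the rectangle, trivially where the weight does
    by_cases hρ : ρ₂ Θ = 0
    · rw [hρ, zero_mul]
    have hΘc : Θ ∈ KZ.cube (e + 2) := CornerCubes.openUnitCube_subset_cube hΘo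
    have hθ₀ : Fin.init (Fin.init Θ) ∈ KZ.cube e := KZ.mem_cube.2 fun s => (KZ.mem_cube.1 hΘc) _
    have hσ : σ (Fin.init (Fin.init Θ)) ≠ 0 := fun h => hρ (by rw [hρ₂, h, zero_mul, zero_mul])
    have hΞ0 : Ξ (Fin.init (Fin.init Θ)) ≠ 0 := fun h => hσ (hσ0 _ hθ₀ (Or.inl h))
    have hΗ0 : Η (Fin.init (Fin.init Θ)) ≠ 0 := fun h => hσ (hσ0 _ hθ₀ (Or.inr h))
    obtain ⟨hΞge, hΞle, hΗge, hΗle⟩ := hΞΗ _ hθ₀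
    have hΞpos : 0 < Ξ (Fin.init (Fin.init Θ)) := lt_of_le_of_ne hΞge (Ne.symm hΞ0)
    have hΗpos : 0 < Η (Fin.init (Fin.init Θ)) := lt_of_le_of_ne hΗge (Ne.symm hΗ0)
    have hs := hΘo (Fin.castSucc (Fin.last e))
    have hs' := hΘo (Fin.last (e + 1))
    have hξ0 : 0 < Ξ₂ Θ := by rw [hΞ₂]; exact mul_pos hΞpos hs.1
    have hξα : Ξ₂ Θ < (α : ℝ) := by
      rw [hΞ₂]; exact (mul_lt_of_lt_one_right hΞpos hs.2).trans_le hΞle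
    have hη0 : 0 < Η₂ Θ := by rw [hΗ₂]; exact mul_pos hΗpos hs'.1
    have hηβ : Η₂ Θ < (β : ℝ) := by
      rw [hΗ₂]; exact (mul_lt_of_lt_one_right hΗpos hs'.2).trans_le hΗle
    have hvan : ∑ a : Fin (m + 2), ∑ b : Fin (m + 2), fd a (Ξ₂ Θ) (Η₂ Θ) * gd b (Ξ₂ Θ) (Η₂ Θ) *
        (Bf ((μ ∘ₗ op a) ∘ₗ opV b) x y (Ξ₂ Θ) (Η₂ Θ) - Bf ((μ ∘ₗ opV b) ∘ₗ op a) x y (Ξ₂ Θ) (Η₂ Θ)) = 0 := by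
      simp only [hBf, LinearMap.comp_apply]
      exact collect_sum_vanish (fun a => fd a (Ξ₂ Θ) (Η₂ Θ)) (fun b => gd b (Ξ₂ Θ) (Η₂ Θ))
        (fun U V => Vt V y (Ξ₂ Θ) (Η₂ Θ) * Ht U x (Ξ₂ Θ) 0)
        (fun a b U V => (μ (op a (opV b (wZ V * wZ U))) : ℝ))
        (fun a b U V => (μ (opV b (op a (wZ V * wZ U))) : ℝ))
        fun U V => sum_weight_commutator H μ (wZ V * wZ U) (Ξ₂ Θ) (Η₂ Θ) hξ0 hξα hη0 hηβ
    rw [hvan, mul_zero]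
  -- integrand additivity off the null boundary
  have hT₁ := CornerCubes.cls_finset_sum_open Finset.univ T
    (Sum.elim E (fun p : Fin (m + 2) × Fin (m + 2) => Φ₂ p.1 p.2)) hTd
    (fun i _ => by
      rcases i with a | ⟨a, b⟩
      · exact hEd a
      · exact hΦ₂d a b) hpt
  rw [Fintype.sum_sum_type] at hT₁
  simp only [Sum.elim_inl, Sum.elim_inr, Fintype.sum_prod_type] at hT₁
  rw [Finset.sum_congr rfl fun b _ => (hE''c b).symm, ← hT₂, hT₁]
  abel

end AbstractEngine

/-- **Hook `cornerEngineCollectDeg2_sum_bookkeeping`** (registered form of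
`collect_sum_bookkeeping`): the finite-sum bookkeeping of the degree-`(n−2)` collection.
[folklore] -/
theorem cornerEngineCollectDeg2_sum_bookkeeping : ∀ (n : ℕ) (ρ : ℝ) (f g : Fin n → ℝ) (A B B' : Fin n → Fin n → ℝ), ρ * (∑ a, ∑ b, f a * g b * (B' a b - B a b)) = 0 → ∑ b, ρ * (g b * ∑ a, f a * A a b) = (∑ a, ρ * (f a * ∑ b, g b * B' a b)) + ∑ a, ∑ b, ρ * (f a * g b) * (A a b - B a b) :=
  fun _ ρ f g A B B' h => collect_sum_bookkeeping ρ f g A B B' h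

end Summit.KontsevichZagierPeriods.FurushoPentagon.PentagonInKZ
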